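import Summits.KontsevichZagierPeriods.KontsevichZagierPeriods.Theses.LiftingCriteria
import Summits.KontsevichZagierPeriods.KontsevichZagierPeriods.Theorems.InverseLandauTateFamilyKernelTameCertificate
import Summits.KontsevichZagierPeriods.KontsevichZagierPeriods.Theorems.HermiteRigidityRealEllipticSectorKernelStubReduction
import Summits.KontsevichZagierPeriods.KontsevichZagierPeriods.Theorems.LiftingCriteriaDilationTransferStubSliceStokes
import Summits.KontsevichZagierPeriods.KontsevichZagierPeriods.Theorems.LiftingCriteriaDilationTransferStubPencilContinuation
import Literature.NumberTheory.Transcendental.SemialgebraicLineDeriv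
import Literature.NumberTheory.Transcendental.KZSubcalculusInvariants
import Literature.NumberTheory.Transcendental.KZLogCalculusProofs

/-!
# `DilationTransfer` from a tame Stokes form of the specialised pencil integrand (crux stmt-KontsevichZagierPeriods-3572)

Support file for crux `DilationTransfer`
(`Summit.KontsevichZagierPeriods.KontsevichZagierPeriods.Theses.LiftingCriteria.DilationTransfer`,
route `LiftingCriteria`, line `birth`). It lands, sorry-free and with explicit hypotheses, the
ASSEMBLY of the line, so that the one remaining open stub can be promoted against tree theorems:

* `dilationTransfer_of_tameStokes` — **the transfer proper.** If, for every datum of the crux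
  (cube-Nash `gᵢ`, integers `mᵢ, m₀`, rational `ϖ₀ ∈ (0,1]`, and a functional-relation witness), the
  SPECIALISED pencil integrand `f₀(z) = m₀ + Σ mᵢ gᵢ(ϖ₀·πᵢ z)`, read on a common cube `[0,1]^D`
  (`nᵢ ≤ D`, `πᵢ` = first `nᵢ` coordinates), is a finite sum of Ayoub elements
  `∂_{c_k} H_k − H_k|_{z_{c_k}=1} + H_k|_{z_{c_k}=0}` with `H_k` `ℚ`-semialgebraic and real-analytic on
  an open set containing the closed cube (a TAME Stokes form), then `DilationTransfer` holds. Proof: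
  the tame representation `A = [[0,1]^D, f₀ ∘ π]` is a relation by the landed calibration toolkit of
  crux `TateFamilyKernel` (`tame_sum_relA_mem_relations_dim`), and `m₀·[u] + Σ mᵢ·[rᵢ] ≡ [A]` in the
  four-move calculus: congruence `rᵢ ≡ [[0,1]^{nᵢ}, gᵢ(ϖ₀·)]`, padding to `[0,1]^D` (`tame_liftLE`,
  the `Fin.castLE` form of the toolkit's `tame_liftLast`), integer scaling
  (`reduction_of_constMul_int_sub_zsmul_mem_relations`) and integrand additivity
  (`KZ.of_sub_sum_integrand_mem_relations`).
* `dilationTransfer_of_pencilStokesGerm` — the line's composition: the registered stub S1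
  (`stub_pencilStokesGerm`: Nash Stokes data for the pencil integrand on a neighbourhood of the slab
  `[0,1]^N × [0, max ε ϖ₀]`, Stokes identity for `ϖ ≤ ε`), taken as a HYPOTHESIS, gives the tame
  Stokes form at `ϖ₀` through the landed stubs S2a (`stub_pencilContinuation`, identity theorem
  along the pencil) and S2b (`stub_sliceStokes`, slicing at `ϖ = ϖ₀`), hence the crux. S1 itself is
  of relative-Kontsevich–Zagier strength (its formal germ is the open question of Ayoub's revisited
  note, Remarque 1.17: `t`-free algebraic Stokes data for `t`-free kernel elements); nothing here
  asserts it.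

## References
* M. Kontsevich, D. Zagier, *Periods* (2001), §1.2 (rules (1)–(3)).
* J. Ayoub, *Periods and the conjectures of Grothendieck and Kontsevich–Zagier*, EMS Newsl. 91
  (2014), Def. 10 (tame cube representations).
* J. Ayoub, *La version relative de la conjecture des périodes de Kontsevich–Zagier revisitée*,
  Tohoku Math. J. 71 (2019), Théorème 1.7, Corollaire 1.15, Exemple 1.16, Remarque 1.17.
-/

noncomputable section

open scoped BigOperators
open MeasureTheory Set Filter
open Literature.NumberTheory.Transcendental
open Literature.ModelTheory.ExponentialFields (IsSemialgebraic)
open Summit.KontsevichZagierPeriods.InverseLandau.TateFamilyKernel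
open Summit.KontsevichZagierPeriods.HermiteRigidity.RealEllipticSectorKernel
  (reduction_of_constMul_int_sub_zsmul_mem_relations)
open Summit.KontsevichZagierPeriods.KontsevichZagierPeriods.Theses.LiftingCriteria (DilationTransfer)

namespace Summit.KontsevichZagierPeriods.LiftingCriteria.DilationTransfer

/-! ### Toolkit: cubes read through the first coordinates -/

/-- Scaling by `a ∈ [0,1]` keeps the closed unit cube. [folklore] -/
theorem smul_mem_cube_of_le {k : ℕ} {a : ℝ} (ha0 : 0 ≤ a) (ha1 : a ≤ 1) {z : Fin k → ℝ}
    (hz : z ∈ KZ.cube k) : a • z ∈ KZ.cube k := fun l => by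
  have h := KZ.mem_cube.1 hz l
  simp only [Pi.smul_apply, smul_eq_mul]
  exact ⟨mul_nonneg ha0 h.1, mul_le_one₀ ha1 h.1 h.2⟩

/-- Reading the first `n ≤ D` coordinates of a point of `[0,1]^D` gives a point of `[0,1]ⁿ`. [folklore] -/
theorem comp_castLE_mem_cube {n D : ℕ} (h : n ≤ D) {v : Fin D → ℝ} (hv : v ∈ KZ.cube D) :
    (fun j => v (Fin.castLE h j)) ∈ KZ.cube n := fun j => KZ.mem_cube.1 hv (Fin.castLE h j)

/-- A function analytic near `[0,1]ⁿ`, read on `[0,1]^D` through the first `n` coordinates, is analytic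
near `[0,1]^D`. [folklore] -/
theorem analyticOnNhd_comp_castLE {n D : ℕ} (h : n ≤ D) {u : (Fin n → ℝ) → ℝ}
    (hua : AnalyticOnNhd ℝ u (KZ.cube n)) :
    AnalyticOnNhd ℝ (fun v : Fin D → ℝ => u (fun j => v (Fin.castLE h j))) (KZ.cube D) := by
  obtain ⟨L, hL⟩ : ∃ L : (Fin D → ℝ) →L[ℝ] (Fin n → ℝ), ∀ v, L v = fun j => v (Fin.castLE h j) :=
    ⟨ContinuousLinearMap.pi fun j => ContinuousLinearMap.proj (Fin.castLE h j), fun v => by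
      ext j; simp⟩
  intro v hv
  have huL : AnalyticAt ℝ u (L v) := by rw [hL]; exact hua _ (comp_castLE_mem_cube h hv)
  exact (huL.comp (L.analyticAt v)).congr (Filter.Eventually.of_forall fun v' => by simp [hL])

/-- A `ℚ`-semialgebraic function on `[0,1]ⁿ`, read on `[0,1]^D` through the first `n` coordinates, is
`ℚ`-semialgebraic on `[0,1]^D`. [cite: BochnakCosteRoy1998, Prop. 2.2.6] -/
theorem isSemialgebraicFunOn_cube_comp_castLE {n D : ℕ} (h : n ≤ D) {u : (Fin n → ℝ) → ℝ}
    (hus : IsSemialgebraicFunOn ℚ (KZ.cube n) u) :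
    IsSemialgebraicFunOn ℚ (KZ.cube D) (fun v : Fin D → ℝ => u (fun j => v (Fin.castLE h j))) :=
  IsSemialgebraicFunOn.comp_isSemialgebraicMapOn_holds hus
    (IsSemialgebraicMapOn.of_forall KZ.isSemialgebraic_cube fun j =>
      isSemialgebraicFunOn_apply KZ.isSemialgebraic_cube (Fin.castLE h j))
    fun _ hv => comp_castLE_mem_cube h hv

/-- `Fin.init` read through `Fin.castLE`. [folklore] -/
theorem init_castLE {n D : ℕ} (h : n ≤ D + 1) (h' : n ≤ D) (w : Fin (D + 1) → ℝ) (j : Fin n) :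
    Fin.init w (Fin.castLE h' j) = w (Fin.castLE h j) := by
  show w (Fin.castSucc (Fin.castLE h' j)) = w (Fin.castLE h j)
  exact congrArg w (Fin.ext rfl)

/-- **Ignoring trailing coordinates is a relation, for tame data (`Fin.castLE` form)**:
`[[0,1]^D, w ↦ u(w₁,…,wₙ)] ≡ [[0,1]ⁿ, u]` for `n ≤ D` — iterated Newton–Leibniz moves
(`tame_liftLast` of the `TateFamilyKernel` toolkit, primitive `w_D · u`).
[cite: KontsevichZagier2001, §1.2 rule (3)] -/
theorem tame_liftLE {n : ℕ} {u : (Fin n → ℝ) → ℝ} (hua : AnalyticOnNhd ℝ u (KZ.cube n))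
    (hus : IsSemialgebraicFunOn ℚ (KZ.cube n) u) :
    ∀ (D : ℕ) (h : n ≤ D) (Uu : KZ.IntegralRep D), Uu.IsTameCube →
      (∀ w ∈ KZ.cube D, Uu.integrand w = u (fun j => w (Fin.castLE h j))) →
      ∀ (u0 : KZ.IntegralRep n), u0.IsTameCube → (∀ x ∈ KZ.cube n, u0.integrand x = u x) →
      KZ.of Uu - KZ.of u0 ∈ KZ.relations := by
  intro D
  induction D with
  | zero =>
    intro h Uu hU hUi u0 hu0 hu0i
    obtain rfl : n = 0 := Nat.le_zero.mp h
    refine KZ.of_sub_of_mem_relations_of_eqOn (by rw [hU.domain_eq, hu0.domain_eq]) fun w hw => ?_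
    rw [hU.domain_eq] at hw
    rw [hUi w hw, hu0i w hw]
    exact congrArg u (funext fun j => j.elim0)
  | succ D ih =>
    intro h Uu hU hUi u0 hu0 hu0i
    by_cases hnD : n ≤ D
    · obtain ⟨Vv, hVt, hVi⟩ : ∃ ρ : KZ.IntegralRep D, ρ.IsTameCube ∧
          ρ.integrand = fun v : Fin D → ℝ => u (fun j => v (Fin.castLE hnD j)) :=
        ⟨KZ.IntegralRep.tameCube _ (analyticOnNhd_comp_castLE hnD hua)
          (isSemialgebraicFunOn_cube_comp_castLE hnD hus), KZ.IntegralRep.isTameCube_tameCube _ _ _, rfl⟩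
      have h1 : KZ.of Uu - KZ.of Vv ∈ KZ.relations :=
        tame_liftLast (analyticOnNhd_comp_castLE hnD hua) (isSemialgebraicFunOn_cube_comp_castLE hnD hus)
          Uu hU (fun w hw => by
            rw [hUi w hw]
            exact congrArg u (funext fun j => (init_castLE h hnD w j).symm))
          Vv hVt (fun v _ => by rw [hVi])
      have h2 : KZ.of Vv - KZ.of u0 ∈ KZ.relations :=
        ih hnD Vv hVt (fun v _ => by rw [hVi]) u0 hu0 hu0i
      have : KZ.of Uu - KZ.of u0 = (KZ.of Uu - KZ.of Vv) + (KZ.of Vv - KZ.of u0) := by abel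
      rw [this]
      exact KZ.relations.add_mem h1 h2
    · obtain rfl : n = D + 1 := le_antisymm h (Nat.succ_le_of_lt (Nat.lt_of_not_le hnD))
      refine KZ.of_sub_of_mem_relations_of_eqOn (by rw [hU.domain_eq, hu0.domain_eq]) fun w hw => ?_
      rw [hU.domain_eq] at hw
      rw [hUi w hw, hu0i w hw]
      exact congrArg u (funext fun j => congrArg w (Fin.ext rfl))

/-! ### The transfer from a tame Stokes form of the specialised integrand -/

/-- **`DilationTransfer` from a tame Stokes form of the specialised pencil integrand.** If for every
datum of the crux the specialised integrand `f₀(z) = m₀ + Σ mᵢ gᵢ(ϖ₀·πᵢ z)`, read on a common cube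
`[0,1]^D` through the first coordinates, is a finite sum of Ayoub elements
`∂_{c_k} H_k − H_k|_{z_{c_k}=1} + H_k|_{z_{c_k}=0}` on `[0,1]^D` with `H_k` `ℚ`-semialgebraic and
real-analytic on an open set containing the closed cube, then the crux holds: the tame
representation `[[0,1]^D, f₀ ∘ π]` is a relation by the calibration
`tame_sum_relA_mem_relations_dim`, and `m₀·[u] + Σ mᵢ·[rᵢ]` is congruent to it by congruence with
tame cube representations, padding (`tame_liftLE`), integer scaling and integrand additivity.
[cite: KontsevichZagier2001, §1.2] [cite: Ayoub2014, Def. 10] -/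
theorem dilationTransfer_of_tameStokes :
    (∀ (S : ℕ) (n : Fin S → ℕ) (g : (i : Fin S) → (Fin (n i) → ℝ) → ℝ) (U : (i : Fin S) → Set (Fin (n i) → ℝ)), (∀ i, IsOpen (U i) ∧ Set.pi Set.univ (fun _ : Fin (n i) => Set.Icc (0:ℝ) 1) ⊆ (U i) ∧ Literature.NumberTheory.Transcendental.IsSemialgebraicFunOn ℚ (U i) (g i) ∧ AnalyticOnNhd ℝ (g i) (U i)) → ∀ (m : Fin S → ℤ) (m₀ : ℤ) (ϖ₀ : ℚ), 0 < ϖ₀ → ϖ₀ ≤ 1 → (∃ (T : ℕ) (d : Fin T → ℕ) (G : (j : Fin T) → (Fin (d j) → ℝ) → ℝ) (V : (j : Fin T) → Set (Fin (d j) → ℝ)) (μ : Fin T → Polynomial ℝ) (μ₀ : Polynomial ℝ), (∀ j, IsOpen (V j) ∧ Set.pi Set.univ (fun _ : Fin (d j) => Set.Icc (0:ℝ) 1) ⊆ (V j) ∧ Literature.NumberTheory.Transcendental.IsSemialgebraicFunOn ℚ (V j) (G j) ∧ AnalyticOnNhd ℝ (G j) (V j)) ∧ (∀ j k, IsAlgebraic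 ℚ ((μ j).coeff k)) ∧ (∀ k, IsAlgebraic ℚ (μ₀.coeff k)) ∧ ∀ ϖ ∈ Set.Icc (0:ℝ) 1, (m₀ : ℝ) + ∑ i, (m i : ℝ) * (∫ z in Set.pi Set.univ (fun _ : Fin (n i) => Set.Icc (0:ℝ) 1), g i (ϖ • z)) = (ϖ - (ϖ₀ : ℝ)) * (μ₀.eval ϖ + ∑ j, (μ j).eval ϖ * (∫ z in Set.pi Set.univ (fun _ : Fin (d j) => Set.Icc (0:ℝ) 1), G j (ϖ • z)))) → ∃ (D : ℕ) (hn : ∀ i, n i ≤ D) (K : ℕ) (c : Fin K → Fin D) (W : Set (Fin D → ℝ)) (H : Fin K → (Fin D → ℝ) → ℝ), IsOpen W ∧ Literature.NumberTheory.Transcendental.KZ.cube D ⊆ W ∧ (∀ k, Literature.NumberTheory.Transcendental.IsSemialgebraicFunOn ℚ W (H k) ∧ AnalyticOnNhd ℝ (H k) W) ∧ ∀ v ∈ Literature.NumberTheory.Transcendental.KZ.cube D, (m₀ : ℝ) + ∑ i, (m i : ℝ) * g i ((ϖ₀ : ℝ) • (fun l : Fin (n i) => v (Fin.castLE (hn i)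 l))) = ∑ k, (fderiv ℝ (H k) v (Pi.single (c k) 1) - H k (Function.update v (c k) 1) + H k (Function.update v (c k) 0))) → Summit.KontsevichZagierPeriods.KontsevichZagierPeriods.Theses.LiftingCriteria.DilationTransfer := by
  intro hT S n g U hg m m₀ ϖ₀ hϖ0 hϖ1 hfun r u hr hu1 hu2
  obtain ⟨D, hle, K', c', W', H', hW'o, hW'c, hH', hcert⟩ := hT S n g U hg m m₀ ϖ₀ hϖ0 hϖ1 hfun
  -- real casts of the parameter
  have hϖ0' : (0 : ℝ) ≤ (ϖ₀ : ℝ) := by exact_mod_cast hϖ0.le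
  have hϖ1' : (ϖ₀ : ℝ) ≤ 1 := by exact_mod_cast hϖ1
  have hcubeU : ∀ i, KZ.cube (n i) ⊆ U i := fun i => by rw [KZ.cube_eq_pi]; exact (hg i).2.1
  -- (1) the specialised integrands `z ↦ gᵢ(ϖ₀ z)` are tame on their cubes
  have ha : ∀ i, AnalyticOnNhd ℝ (fun z : Fin (n i) → ℝ => g i ((ϖ₀ : ℝ) • z)) (KZ.cube (n i)) := by
    intro i z hz
    have hgz : AnalyticAt ℝ (g i) ((ϖ₀ : ℝ) • z) :=
      (hg i).2.2.2 _ (hcubeU i (smul_mem_cube_of_le hϖ0' hϖ1' hz))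
    have hL : AnalyticAt ℝ (fun z : Fin (n i) → ℝ => (ϖ₀ : ℝ) • z) z :=
      ((ϖ₀ : ℝ) • ContinuousLinearMap.id ℝ (Fin (n i) → ℝ)).analyticAt z
    exact hgz.comp hL
  have hs : ∀ i, IsSemialgebraicFunOn ℚ (KZ.cube (n i)) (fun z : Fin (n i) → ℝ => g i ((ϖ₀ : ℝ) • z)) := by
    intro i
    have hmap : IsSemialgebraicMapOn ℚ (KZ.cube (n i)) (fun z : Fin (n i) → ℝ => (ϖ₀ : ℝ) • z) :=
      IsSemialgebraicMapOn.of_forall KZ.isSemialgebraic_cube fun l =>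
        ((isSemialgebraicFunOn_const_ratCast KZ.isSemialgebraic_cube ϖ₀).fun_mul
          (isSemialgebraicFunOn_apply KZ.isSemialgebraic_cube l)).congr fun z _ => by
            simp [Pi.smul_apply, smul_eq_mul]
    exact IsSemialgebraicFunOn.comp_isSemialgebraicMapOn_holds (hg i).2.2.1 hmap
      fun z hz => hcubeU i (smul_mem_cube_of_le hϖ0' hϖ1' hz)
  -- tame representations `r'ᵢ = [[0,1]^{nᵢ}, gᵢ(ϖ₀ ·)]`, congruent to the given `rᵢ`
  have hex1 : ∀ i, ∃ ρ : KZ.IntegralRep (n i), ρ.IsTameCube ∧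
      ρ.integrand = fun z => g i ((ϖ₀ : ℝ) • z) :=
    fun i => ⟨KZ.IntegralRep.tameCube _ (ha i) (hs i), KZ.IntegralRep.isTameCube_tameCube _ _ _, rfl⟩
  choose r' hr't hr'i using hex1
  have hr'r : ∀ i, KZ.of (r' i) - KZ.of (r i) ∈ KZ.relations := by
    intro i
    refine KZ.of_sub_of_mem_relations_of_eqOn ?_ fun z hz => ?_
    · rw [(hr i).1, (hr't i).domain_eq, KZ.cube_eq_pi]
    · rw [(hr't i).domain_eq] at hz
      have hz' : z ∈ Set.pi Set.univ (fun _ : Fin (n i) => Set.Icc (0:ℝ) 1) := by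
        rw [← KZ.cube_eq_pi]; exact hz
      rw [hr'i i]
      exact ((hr i).2 z hz').symm
  -- (2) pad to the common cube `[0,1]^D`
  have hex2 : ∀ i, ∃ ρ : KZ.IntegralRep D, ρ.IsTameCube ∧
      ρ.integrand = fun v => g i ((ϖ₀ : ℝ) • (fun l : Fin (n i) => v (Fin.castLE (hle i) l))) :=
    fun i => ⟨KZ.IntegralRep.tameCube _ (analyticOnNhd_comp_castLE (hle i) (ha i))
      (isSemialgebraicFunOn_cube_comp_castLE (hle i) (hs i)), KZ.IntegralRep.isTameCube_tameCube _ _ _, rfl⟩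
  choose R hRt hRi using hex2
  have hRr' : ∀ i, KZ.of (R i) - KZ.of (r' i) ∈ KZ.relations := fun i =>
    tame_liftLE (ha i) (hs i) D (hle i) (R i) (hRt i) (fun w _ => by rw [hRi i])
      (r' i) (hr't i) (fun x _ => by rw [hr'i i])
  -- the unit representation `u = [pt, 1]`, tame in dimension `0`, padded to `[0,1]^D`
  have hut : u.IsTameCube := by
    refine ⟨by rw [hu1, KZ.cube_zero], ?_⟩
    have : u.integrand = fun _ => 1 := funext hu2
    rw [this]
    exact analyticOnNhd_const
  have h1s : IsSemialgebraicFunOn ℚ (KZ.cube 0) (fun _ : Fin 0 → ℝ => (1 : ℝ)) := by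
    simpa using isSemialgebraicFunOn_const_natCast (KZ.isSemialgebraic_cube (n := 0)) 1
  have h1sD : IsSemialgebraicFunOn ℚ (KZ.cube D) (fun _ : Fin D → ℝ => (1 : ℝ)) := by
    simpa using isSemialgebraicFunOn_const_natCast (KZ.isSemialgebraic_cube (n := D)) 1
  obtain ⟨One, hOt, hOi⟩ : ∃ ρ : KZ.IntegralRep D, ρ.IsTameCube ∧
      ρ.integrand = fun _ => (1 : ℝ) :=
    ⟨KZ.IntegralRep.tameCube _ analyticOnNhd_const h1sD, KZ.IntegralRep.isTameCube_tameCube _ _ _, rfl⟩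
  have hOu : KZ.of One - KZ.of u ∈ KZ.relations :=
    tame_liftLE (u := fun _ : Fin 0 → ℝ => (1 : ℝ)) analyticOnNhd_const h1s D (Nat.zero_le _)
      One hOt (fun w _ => by rw [hOi]) u hut (fun x _ => hu2 x)
  -- (3) the specialised pencil integrand `f₀ ∘ π` on `[0,1]^D` and its tame representation `A`
  have hf0s : IsSemialgebraicFunOn ℚ (KZ.cube D) (fun v : Fin D → ℝ =>
      (m₀ : ℝ) + ∑ i, (m i : ℝ) * g i ((ϖ₀ : ℝ) • (fun l : Fin (n i) => v (Fin.castLE (hle i) l)))) := by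
    have hterm : ∀ i ∈ (Finset.univ : Finset (Fin S)), IsSemialgebraicFunOn ℚ (KZ.cube D)
        (fun v : Fin D → ℝ => (m i : ℝ) * g i ((ϖ₀ : ℝ) • (fun l : Fin (n i) => v (Fin.castLE (hle i) l)))) :=
      fun i _ => (isSemialgebraicFunOn_const_intCast KZ.isSemialgebraic_cube (m i)).fun_mul
        (isSemialgebraicFunOn_cube_comp_castLE (hle i) (hs i))
    exact (isSemialgebraicFunOn_const_intCast KZ.isSemialgebraic_cube m₀).fun_add
      (IsSemialgebraicFunOn.fun_finsetSum Finset.univ KZ.isSemialgebraic_cube hterm)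
  have hf0a : AnalyticOnNhd ℝ (fun v : Fin D → ℝ =>
      (m₀ : ℝ) + ∑ i, (m i : ℝ) * g i ((ϖ₀ : ℝ) • (fun l : Fin (n i) => v (Fin.castLE (hle i) l))))
      (KZ.cube D) := by
    intro v hv
    have hsum : AnalyticAt ℝ (fun v : Fin D → ℝ =>
        ∑ i, (m i : ℝ) * g i ((ϖ₀ : ℝ) • (fun l : Fin (n i) => v (Fin.castLE (hle i) l)))) v :=
      Finset.analyticAt_fun_sum (f := fun i (v : Fin D → ℝ) =>
          (m i : ℝ) * g i ((ϖ₀ : ℝ) • (fun l : Fin (n i) => v (Fin.castLE (hle i) l))))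
        Finset.univ fun i _ => analyticAt_const.fun_mul (analyticOnNhd_comp_castLE (hle i) (ha i) v hv)
    exact analyticAt_const.fun_add hsum
  obtain ⟨A, hAt, hAi⟩ : ∃ ρ : KZ.IntegralRep D, ρ.IsTameCube ∧
      ρ.integrand = fun v : Fin D → ℝ =>
        (m₀ : ℝ) + ∑ i, (m i : ℝ) * g i ((ϖ₀ : ℝ) • (fun l : Fin (n i) => v (Fin.castLE (hle i) l))) :=
    ⟨KZ.IntegralRep.tameCube _ hf0a hf0s, KZ.IntegralRep.isTameCube_tameCube _ _ _, rfl⟩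
  -- (4) calibration: `[A]` is a relation (landed toolkit of crux `TateFamilyKernel`)
  have hHa : ∀ k, AnalyticOnNhd ℝ (H' k) (KZ.cube D) := fun k => (hH' k).2.mono hW'c
  have hHs : ∀ k, IsSemialgebraicFunOn ℚ (KZ.cube D) (H' k) := fun k =>
    (hH' k).1.mono hW'c KZ.isSemialgebraic_cube
  have hDa : ∀ k, AnalyticOnNhd ℝ (fun v => fderiv ℝ (H' k) v (Pi.single (c' k) 1)) (KZ.cube D) := by
    intro k v hv
    have hfd : AnalyticAt ℝ (fderiv ℝ (H' k)) v := ((hH' k).2 v (hW'c hv)).fderiv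
    have happ := ((ContinuousLinearMap.apply ℝ ℝ (Pi.single (c' k) (1 : ℝ))).analyticAt _).comp hfd
    exact happ.congr (Filter.Eventually.of_forall fun y => by simp)
  have hDs : ∀ k, IsSemialgebraicFunOn ℚ (KZ.cube D) (fun v => fderiv ℝ (H' k) v (Pi.single (c' k) 1)) :=
    fun k => (IsSemialgebraicFunOn.fderiv_apply_single hW'o (hH' k).1
      (fun x hx => ((hH' k).2 x hx).differentiableAt) (c' k)).mono hW'c KZ.isSemialgebraic_cube
  have hder : ∀ k, ∀ w ∈ KZ.cube D,
      HasDerivAt (fun t : ℝ => H' k (Function.update w (c' k) t))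
        (fderiv ℝ (H' k) w (Pi.single (c' k) 1)) (w (c' k)) := by
    intro k w hw
    have hdf : HasFDerivAt (H' k) (fderiv ℝ (H' k) w) w :=
      ((hH' k).2 w (hW'c hw)).differentiableAt.hasFDerivAt
    exact HasFDerivAt.comp_hasDerivAt_of_eq (w (c' k)) hdf (hasDerivAt_update w (c' k) (w (c' k)))
      (Function.update_eq_self (c' k) w).symm
  have hA : KZ.of A ∈ KZ.relations :=
    tame_sum_relA_mem_relations_dim Finset.univ c' (G := H')
      (G' := fun k v => fderiv ℝ (H' k) v (Pi.single (c' k) 1))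
      (fun k _ => hHa k) (fun k _ => hHs k) (fun k _ => hDa k) (fun k _ => hDs k)
      (fun k _ w hw => hder k w hw) A hAt (fun w hw => by rw [hAi]; exact hcert w hw)
  -- (5) recombination in the four-move calculus: scaled representations and additivity
  set Rc : Option (Fin S) → KZ.IntegralRep D := fun o =>
    o.elim (One.constMul (m₀ : ℝ) (isAlgebraic_int m₀))
      (fun i => (R i).constMul (m i : ℝ) (isAlgebraic_int (m i))) with hRc
  have hRc0 : Rc none = One.constMul (m₀ : ℝ) (isAlgebraic_int m₀) := rfl
  have hRcs : ∀ i, Rc (some i) = (R i).constMul (m i : ℝ) (isAlgebraic_int (m i)) := fun i => rfl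
  have hsum : KZ.of A - ∑ o, KZ.of (Rc o) ∈ KZ.relations := by
    refine KZ.of_sub_sum_integrand_mem_relations Finset.univ Rc A (fun o _ => ?_) fun v hv => ?_
    · cases o with
      | none => rw [hRc0, KZ.IntegralRep.domain_constMul, hOt.domain_eq, hAt.domain_eq]
      | some i => rw [hRcs i, KZ.IntegralRep.domain_constMul, (hRt i).domain_eq, hAt.domain_eq]
    · show A.integrand v = ∑ o, (Rc o).integrand v
      rw [Fintype.sum_option]
      simp only [hRc0, hRcs, KZ.IntegralRep.integrand_constMul, hAi, hOi, hRi, mul_one]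
  have hsc0 : KZ.of (Rc none) - m₀ • KZ.of One ∈ KZ.relations := by
    rw [hRc0]; exact reduction_of_constMul_int_sub_zsmul_mem_relations One m₀
  have hsci : ∀ i, KZ.of (Rc (some i)) - m i • KZ.of (R i) ∈ KZ.relations := fun i => by
    rw [hRcs i]; exact reduction_of_constMul_int_sub_zsmul_mem_relations (R i) (m i)
  -- (6) assembly of the pieces
  have step1 : KZ.of (Rc none) + ∑ i, KZ.of (Rc (some i)) ∈ KZ.relations := by
    have h := KZ.relations.sub_mem hA hsum
    rw [sub_sub_cancel, Fintype.sum_option] at h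
    exact h
  have step2 : m₀ • KZ.of One + ∑ i, m i • KZ.of (R i) ∈ KZ.relations := by
    have h4 : ∑ i, (KZ.of (Rc (some i)) - m i • KZ.of (R i)) ∈ KZ.relations :=
      KZ.relations.sum_mem fun i _ => hsci i
    have h := KZ.relations.sub_mem (KZ.relations.sub_mem step1 hsc0) h4
    have e : KZ.of (Rc none) + ∑ i, KZ.of (Rc (some i)) - (KZ.of (Rc none) - m₀ • KZ.of One) -
        ∑ i, (KZ.of (Rc (some i)) - m i • KZ.of (R i)) = m₀ • KZ.of One + ∑ i, m i • KZ.of (R i) := by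
      rw [Finset.sum_sub_distrib]; abel
    rwa [e] at h
  have step3 : m₀ • KZ.of u + ∑ i, m i • KZ.of (r i) ∈ KZ.relations := by
    have h5 : m₀ • (KZ.of One - KZ.of u) ∈ KZ.relations := KZ.relations.zsmul_mem hOu m₀
    have h6 : ∑ i, m i • (KZ.of (R i) - KZ.of (r i)) ∈ KZ.relations :=
      KZ.relations.sum_mem fun i _ => KZ.relations.zsmul_mem
        (by have := KZ.relations.add_mem (hRr' i) (hr'r i); rwa [sub_add_sub_cancel] at this) (m i)
    have h := KZ.relations.sub_mem (KZ.relations.sub_mem step2 h5) h6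
    have e : m₀ • KZ.of One + ∑ i, m i • KZ.of (R i) - m₀ • (KZ.of One - KZ.of u) -
        ∑ i, m i • (KZ.of (R i) - KZ.of (r i)) = m₀ • KZ.of u + ∑ i, m i • KZ.of (r i) := by
      simp only [zsmul_sub, Finset.sum_sub_distrib]; abel
    rwa [e] at h
  exact step3

/-! ### The line's composition: the crux from the pencil Stokes germ (stub S1) -/

/-- **`DilationTransfer` from the pencil Stokes germ with Nash data up to `ϖ₀`** (the composition of
line `birth`, with the registered stub S1 `stub_pencilStokesGerm` as an explicit HYPOTHESIS): S1's
Nash Stokes data on a neighbourhood of the slab `[0,1]^N × [0, max ε ϖ₀]` (identity for `ϖ ≤ ε`)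
persist to the slice `ϖ = ϖ₀` by the identity theorem (landed S2a, `stub_pencilContinuation`),
restrict there to a tame Stokes form of `f₀ ∘ π` on `[0,1]^{N+M}` (landed S2b, `stub_sliceStokes`),
and `dilationTransfer_of_tameStokes` concludes. S1 is of relative-Kontsevich–Zagier strength and is
NOT asserted here. [cite: KontsevichZagier2001, §1.2] [cite: AyoubRelKZRevisited, Remarque 1.17] -/
theorem dilationTransfer_of_pencilStokesGerm :
    (∀ (S : ℕ) (n : Fin S → ℕ) (g : (i : Fin S) → (Fin (n i) → ℝ) → ℝ) (U : (i : Fin S) → Set (Fin (n i) → ℝ)), (∀ i, IsOpen (U i) ∧ Set.pi Set.univ (fun _ : Fin (n i) => Set.Icc (0:ℝ) 1) ⊆ (U i) ∧ Literature.NumberTheory.Transcendental.IsSemialgebraicFunOn ℚ (U i) (g i) ∧ AnalyticOnNhd ℝ (g i) (U i)) → ∀ (m : Fin S → ℤ) (m₀ : ℤ) (ϖ₀ : ℚ), 0 < ϖ₀ → ϖ₀ ≤ 1 → ∀ (T : ℕ) (d : Fin T → ℕ) (G : (j : Fin T) → (Fin (d j) → ℝ) → ℝ) (V : (j : Fin T)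 → Set (Fin (d j) → ℝ)) (μ : Fin T → Polynomial ℝ) (μ₀ : Polynomial ℝ), (∀ j, IsOpen (V j) ∧ Set.pi Set.univ (fun _ : Fin (d j) => Set.Icc (0:ℝ) 1) ⊆ (V j) ∧ Literature.NumberTheory.Transcendental.IsSemialgebraicFunOn ℚ (V j) (G j) ∧ AnalyticOnNhd ℝ (G j) (V j)) → (∀ j k, IsAlgebraic ℚ ((μ j).coeff k)) → (∀ k, IsAlgebraic ℚ (μ₀.coeff k)) → (∀ ϖ ∈ Set.Icc (0:ℝ) 1, (m₀ : ℝ) + ∑ i, (m i : ℝ) * (∫ z in Set.pi Set.univ (fun _ : Fin (n i) => Set.Icc (0:ℝ) 1), g i (ϖ • z)) = (ϖ - (ϖ₀ : ℝ)) * (μ₀.eval ϖ + ∑ j, (μ j).eval ϖ * (∫ z in Set.pi Set.univ (fun _ : Fin (d j) => Set.Icc (0:ℝ) 1), G j (ϖ • z)))) → ∃ (N : ℕ) (hn : ∀ i, n i ≤ N) (hd : ∀ j, d j ≤ N) (ε : ℝ), 0 < ε ∧ ∃ (K : ℕ) (c : Fin K → Fin N) (W : Set (Fin (N + 1) → ℝ))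 (H : Fin K → (Fin (N + 1) → ℝ) → ℝ), (IsOpen W ∧ {w : Fin (N + 1) → ℝ | Fin.init w ∈ Literature.NumberTheory.Transcendental.KZ.cube N ∧ 0 ≤ w (Fin.last N) ∧ w (Fin.last N) ≤ max ε (ϖ₀ : ℝ)} ⊆ W ∧ (∀ k, Literature.NumberTheory.Transcendental.IsSemialgebraicFunOn ℚ W (H k) ∧ AnalyticOnNhd ℝ (H k) W) ∧ ∀ w ∈ Literature.NumberTheory.Transcendental.KZ.cube (N + 1), w (Fin.last N) ≤ ε → (m₀ : ℝ) + ∑ i, (m i : ℝ) * g i (w (Fin.last N) • (fun l : Fin (n i) => w (Fin.castSucc (Fin.castLE (hn i) l)))) - (w (Fin.last N) - (ϖ₀ : ℝ)) * (μ₀.eval (w (Fin.last N)) + ∑ j, (μ j).eval (w (Fin.last N)) * G j (w (Fin.last N) • (fun l : Fin (d j) => w (Fin.castSucc (Fin.castLE (hd j) l))))) = ∑ k, (fderiv ℝ (H k) w (Pi.single (Fin.castSucc (c k)) 1) - H k (Function.update w (Fin.castSucc (c k)) 1) + H k (Function.update w (Fin.castSucc (c k)) 0)))) → Summit.KontsevichZagierPeriods.KontsevichZagierPeriods.Theses.LiftingCriteria.DilationTransfer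 := by
  intro h1
  refine dilationTransfer_of_tameStokes fun S n g U hg m m₀ ϖ₀ hϖ0 hϖ1 hfun => ?_
  obtain ⟨T, d, G, V, μ, μ₀, hG, hμ, hμ₀, hrel⟩ := hfun
  obtain ⟨N, hn, hd, ε, hε, K, c, W, H, hgerm⟩ :=
    h1 S n g U hg m m₀ ϖ₀ hϖ0 hϖ1 T d G V μ μ₀ hG hμ hμ₀ hrel
  obtain ⟨M, K', c', W₀, H₀, hW₀o, hW₀c, hH₀, hslice⟩ :=
    stub_pencilContinuation S n g U hg m m₀ ϖ₀ hϖ0 hϖ1 T d G V μ μ₀ hG hμ hμ₀ hrel N hn hd ε hε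
      K c W H hgerm
  obtain ⟨W', H', hW'o, hW'c, hH', hcert⟩ :=
    stub_sliceStokes (N + M) (fun v : Fin (N + M) → ℝ => (m₀ : ℝ) + ∑ i, (m i : ℝ) *
        g i ((ϖ₀ : ℝ) • (fun l : Fin (n i) => v (Fin.castLE ((hn i).trans (Nat.le_add_right N M)) l))))
      ϖ₀ K' c' W₀ H₀ hW₀o hW₀c hH₀ hslice
  exact ⟨N + M, fun i => (hn i).trans (Nat.le_add_right N M), K', c', W', H', hW'o, hW'c, hH', hcert⟩

end Summit.KontsevichZagierPeriods.LiftingCriteria.DilationTransfer
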